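import Summits.CriticalPhenomena.PercolationContinuityZ3.Theorems.PercNearOneGluingNoHeavyLowerTailSahiGridPatternZeroLocus

/-!
# `NoHeavyLowerTail` (crux stmt-CriticalPhenomena-4575), Sahi programme P1: block-measurability tools for the equality case of coefficientwise Harris

Support file (Sahi cell, seat `prim-sahi-p1`, generation 14; `--supports stmt-CriticalPhenomena-4575`).  Pure proofs, no definitions, no `sorry`,
standard axioms.  Small lemmas used by `…SahiGridPatternHarrisEquality`: measurability of a subset of `[3]^n` with respect to a block of axes is
stable under intersecting blocks (`meas_inter`), co-measurability under unions (`comeas_union`); an `I`-measurable up-set is entered by raising /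
left by lowering the `I`-coordinates (`mem_of_le_on_of_meas`, `not_mem_of_le_on_of_meas`); and the pointwise equality case of the Harris slicing
step (`offdiag_eq_two_diag_cases`: for nested `0/1` triples `Σ_{i≠j} uᵢvⱼ = 2Σᵢuᵢvᵢ` forces `u₂ = 0 ∨ v₂ = 0 ∨ u₀ = 1 ∨ v₀ = 1`). [this work]
-/

namespace Summit.CriticalPhenomena.PercolationContinuityZ3.Theorems.SahiGridPattern

open Finset SahiGrid3
open scoped BigOperators

variable {n : ℕ}

/-! ### Small tools: block measurability -/

/-- Measurable w.r.t. `I₁` and w.r.t. `I₂` ⟹ measurable w.r.t. `I₁ ∩ I₂`. [this work] -/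
theorem meas_inter {S : Finset (Pd n)} {I₁ I₂ : Finset (Fin n)}
    (h₁ : ∀ x y : Pd n, (∀ a ∈ I₁, x a = y a) → (x ∈ S ↔ y ∈ S))
    (h₂ : ∀ x y : Pd n, (∀ a ∈ I₂, x a = y a) → (x ∈ S ↔ y ∈ S)) :
    ∀ x y : Pd n, (∀ a ∈ I₁ ∩ I₂, x a = y a) → (x ∈ S ↔ y ∈ S) := by
  intro x y hxy
  let z : Pd n := fun a => if a ∈ I₁ then x a else y a
  have hxz : x ∈ S ↔ z ∈ S := h₁ x z fun a ha => by show x a = (if a ∈ I₁ then x a else y a); rw [if_pos ha]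
  have hzy : z ∈ S ↔ y ∈ S := h₂ z y fun a ha => by
    show (if a ∈ I₁ then x a else y a) = y a
    by_cases h1 : a ∈ I₁
    · rw [if_pos h1]; exact hxy a (Finset.mem_inter.2 ⟨h1, ha⟩)
    · rw [if_neg h1]
  exact hxz.trans hzy

/-- Co-measurable w.r.t. `I₁` and w.r.t. `I₂` (membership depends only on the coordinates OUTSIDE) ⟹ co-measurable w.r.t. `I₁ ∪ I₂`. [this work] -/
theorem comeas_union {S : Finset (Pd n)} {I₁ I₂ : Finset (Fin n)}
    (h₁ : ∀ x y : Pd n, (∀ a ∉ I₁, x a = y a) → (x ∈ S ↔ y ∈ S))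
    (h₂ : ∀ x y : Pd n, (∀ a ∉ I₂, x a = y a) → (x ∈ S ↔ y ∈ S)) :
    ∀ x y : Pd n, (∀ a ∉ I₁ ∪ I₂, x a = y a) → (x ∈ S ↔ y ∈ S) := by
  intro x y hxy
  let z : Pd n := fun a => if a ∈ I₁ then y a else x a
  have hxz : x ∈ S ↔ z ∈ S := h₁ x z fun a ha => by show x a = (if a ∈ I₁ then y a else x a); rw [if_neg ha]
  have hzy : z ∈ S ↔ y ∈ S := h₂ z y fun a ha => by
    show (if a ∈ I₁ then y a else x a) = y a
    by_cases h1 : a ∈ I₁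
    · rw [if_pos h1]
    · rw [if_neg h1]; exact hxy a (fun h => by rcases Finset.mem_union.1 h with h' | h' <;> [exact h1 h'; exact ha h'])
  exact hxz.trans hzy

/-- An `I`-measurable up-set is entered by raising the `I`-coordinates of a member. [this work] -/
theorem mem_of_le_on_of_meas {S : Finset (Pd n)} (hS : IsUpperSet (S : Set (Pd n))) {P : Fin n → Prop} [DecidablePred P]
    (hmeas : ∀ x y : Pd n, (∀ a, P a → x a = y a) → (x ∈ S ↔ y ∈ S)) {x y : Pd n} (hx : x ∈ S) (hle : ∀ a, P a → x a ≤ y a) :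
    y ∈ S := by
  let z : Pd n := fun a => if P a then y a else x a
  have hxz : x ≤ z := fun a => by
    show x a ≤ (if P a then y a else x a)
    by_cases h : P a
    · rw [if_pos h]; exact hle a h
    · rw [if_neg h]
  have hz : z ∈ S := hS hxz hx
  exact (hmeas z y fun a ha => by show (if P a then y a else x a) = y a; rw [if_pos ha]).1 hz

/-- An `I`-measurable up-set is left by lowering the `I`-coordinates of a non-member. [this work] -/
theorem not_mem_of_le_on_of_meas {S : Finset (Pd n)} (hS : IsUpperSet (S : Set (Pd n))) {P : Fin n → Prop} [DecidablePred P]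
    (hmeas : ∀ x y : Pd n, (∀ a, P a → x a = y a) → (x ∈ S ↔ y ∈ S)) {x y : Pd n} (hx : x ∉ S) (hle : ∀ a, P a → y a ≤ x a) :
    y ∉ S :=
  fun hy => hx (mem_of_le_on_of_meas hS hmeas hy hle)

/-- The pointwise equality case of the Harris induction: for nested `0/1` triples, `Σ_{i≠j} uᵢvⱼ = 2Σᵢuᵢvᵢ` forces `u₂ = 0 ∨ v₂ = 0 ∨ u₀ = 1 ∨ v₀ = 1`
(i.e. the point is NOT strictly between the bottom and top slices of both sets). [this work] -/
theorem offdiag_eq_two_diag_cases (u0 u1 u2 v0 v1 v2 : ℤ) (hu0 : u0 = 0 ∨ u0 = 1) (hu1 : u1 = 0 ∨ u1 = 1) (hu2 : u2 = 0 ∨ u2 = 1)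
    (hv0 : v0 = 0 ∨ v0 = 1) (hv1 : v1 = 0 ∨ v1 = 1) (hv2 : v2 = 0 ∨ v2 = 1)
    (hu01 : u0 ≤ u1) (hu12 : u1 ≤ u2) (hv01 : v0 ≤ v1) (hv12 : v1 ≤ v2)
    (heq : u0 * v1 + u0 * v2 + u1 * v0 + u1 * v2 + u2 * v0 + u2 * v1 = 2 * (u0 * v0 + u1 * v1 + u2 * v2)) :
    u2 = 0 ∨ v2 = 0 ∨ u0 = 1 ∨ v0 = 1 := by
  rcases hu0 with rfl | rfl <;> rcases hu1 with rfl | rfl <;> rcases hu2 with rfl | rfl <;>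
    rcases hv0 with rfl | rfl <;> rcases hv1 with rfl | rfl <;> rcases hv2 with rfl | rfl <;> omega

end Summit.CriticalPhenomena.PercolationContinuityZ3.Theorems.SahiGridPattern
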